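import Mathlib
import HarnessLib
import Summits.CriticalPhenomena.PercolationContinuityZ3.Theorems.PercNearOneGluingNoHeavyLowerTailKnQuestion8AntitheticRoutingDefs

/-!
# `NoHeavyLowerTail` (crux stmt-CriticalPhenomena-4575), antithetic vdBHK programme: the HUB LEMMA of the routing-lemma induction
# (PROOF-RL-g43 P3), abstractly

Support file (seat `prim-ineq-gen-7` gen 43; `--supports stmt-CriticalPhenomena-4575`).  Nothing is asserted about the crux; no `sorry`, no definitions.
Uses `…AntitheticRoutingDefs` (`AntitheticLegStr`, `Natural`, `hub`).  Memo: PROOF-RL-g43.md P3.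
* `AntitheticLegStr.natural_hub` — HUB LEMMA: if `sub` of `S′` is reflexive, `blt` of `S′` is reflexive (`b_u < t_u`) and `S′` is natural, then
  `hub S′` is natural (the explicit four-case assignment of P3 over the inner matching).
-/

namespace Summit.CriticalPhenomena.PercolationContinuityZ3.Theorems

namespace AntitheticLegStr

variable {Λ : Type*}

/-- **HUB LEMMA (PROOF-RL-g43 P3).**  If the cube order of `S′` is reflexive, `b_u < t_u` holds in `S′` (`blt` reflexive; PROOF-RL P1′) and `S′`
satisfies (♮), then `hub S′` satisfies (♮).
Proof: the explicit four-case assignment of P3 on top of the inner matching `M′` obtained from (♮)(S′) for the restricted down-set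
`(U_b, U_t)` with `F*′ = F*_β`. [this work] -/
theorem natural_hub [Fintype Λ] [DecidableEq Λ] (S' : AntitheticLegStr Λ) (hrefl : ∀ x, S'.sub x x)
    (hbrefl : ∀ x, S'.blt x x) (hN : S'.Natural) : (hub S').Natural := by
  classical
  intro Db Dt Fs hDb hDt hcross hFs hL hFsDb
  -- the inner down-set (U_b, U_t) and F*_β
  set Ub : Finset Λ := Finset.univ.filter (fun u => ((true, u) : Bool × Λ) ∈ Db) with hUb
  set Ut : Finset Λ := Finset.univ.filter (fun y => ((false, y) : Bool × Λ) ∈ Dt) with hUt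
  set Fsb : Finset Λ := Finset.univ.filter (fun u => ((true, u) : Bool × Λ) ∈ Fs) with hFsb
  have mUb : ∀ u, u ∈ Ub ↔ ((true, u) : Bool × Λ) ∈ Db := by intro u; simp [hUb]
  have mUt : ∀ y, y ∈ Ut ↔ ((false, y) : Bool × Λ) ∈ Dt := by intro y; simp [hUt]
  have mFsb : ∀ u, u ∈ Fsb ↔ ((true, u) : Bool × Λ) ∈ Fs := by intro u; simp [hFsb]
  -- unfolded forms of the hub relations
  have hble_tt : ∀ u u' : Λ, (hub S').ble ((true, u') : Bool × Λ) (true, u) ↔ S'.ble u' u := by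
    intro u u'; simp [hub]
  have hble_ff : ∀ y y' : Λ, (hub S').ble ((false, y') : Bool × Λ) (false, y) ↔ S'.sub y' y := by
    intro y y'; simp [hub]
  have htle_ff : ∀ y y' : Λ, (hub S').tle ((false, y') : Bool × Λ) (false, y) ↔ S'.tle y' y := by
    intro y y'; simp [hub]
  have hblt_tf : ∀ u y : Λ, (hub S').blt ((true, u) : Bool × Λ) (false, y) ↔ S'.blt u y := by
    intro u y; simp [hub]
  have hblt_tt : ∀ u y : Λ, (hub S').blt ((true, u) : Bool × Λ) (true, y) ↔ S'.sub u y := by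
    intro u y; simp [hub]
  have hblt_f : ∀ (y : Λ) (q : Bool × Λ), (hub S').blt ((false, y) : Bool × Λ) q ↔ S'.sub y q.2 := by
    intro y q; simp [hub]
  have hΦ_t : ∀ u : Λ, (hub S').Φ ((true, u) : Bool × Λ) = (false, S'.Φ u) := by intro u; simp [hub]
  have hΦ_f : ∀ y : Λ, (hub S').Φ ((false, y) : Bool × Λ) = (true, y) := by intro y; simp [hub]
  have hsub_ff : ∀ y y' : Λ, (hub S').sub ((false, y') : Bool × Λ) (false, y) ↔ S'.sub y' y := by
    intro y y'; simp [hub]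
  have hsub_ft : ∀ y u : Λ, (hub S').sub ((false, y) : Bool × Λ) (true, u) ↔ S'.sub y u := by
    intro y u; simp [hub]
  have hsub_tt : ∀ u u' : Λ, (hub S').sub ((true, u') : Bool × Λ) (true, u) ↔ S'.sub u' u := by
    intro u u'; simp [hub]
  have hsub_tf : ∀ u y : Λ, ¬ (hub S').sub ((true, u) : Bool × Λ) (false, y) := by
    intro u y; simp [hub]
  -- the inner hypothesis
  obtain ⟨M', hM1, hM2, hM3, hM4⟩ := hN Ub Ut Fsb
    (by intro ρ ρ' h hρ; rw [mUb] at hρ ⊢; exact hDb _ _ ((hble_tt ρ ρ').mpr h) hρ)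
    (by intro σ σ' h hσ; rw [mUt] at hσ ⊢; exact hDt _ _ ((htle_ff σ σ').mpr h) hσ)
    (by intro ρ σ h hσ; rw [mUt] at hσ; rw [mUb]; exact hcross _ _ ((hblt_tf ρ σ).mpr h) hσ)
    (by intro ρ ρ' h hρ; rw [mFsb] at hρ ⊢; exact hFs _ _ ((hble_tt ρ ρ').mpr h) hρ)
    (by intro ρ σ hσ h; rw [mUt] at hσ; rw [mFsb]; exact hL _ _ hσ ((hblt_tf ρ σ).mpr h))
    (by intro u hu; rw [mFsb] at hu; rw [mUb]; exact hFsDb hu)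
  -- COND(u): β_u is a source lying in the cube interior of F*
  let COND : Λ → Prop := fun u => ((true, u) : Bool × Λ) ∈ Db ∧ ((true, u) : Bool × Λ) ∉ Dt ∧
    ((false, u) : Bool × Λ) ∉ Dt ∧ (∀ u', S'.sub u' u → ((true, u') : Bool × Λ) ∈ Fs) ∧ ((false, u) : Bool × Λ) ∈ Fs
  -- the assignment
  let M : Bool × Λ → Bool × Λ := fun p =>
    if p.1 = true then
      (if ((false, p.2) : Bool × Λ) ∈ Dt ∨ COND p.2 then (false, p.2) else (true, M' p.2))
    else
      (if ((true, p.2) : Bool × Λ) ∈ Dt ∨ COND p.2 then (true, M' p.2) else (false, p.2))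
  have Mt : ∀ u, M (true, u) = (if ((false, u) : Bool × Λ) ∈ Dt ∨ COND u then (false, u) else (true, M' u)) := by
    intro u; simp [M]
  have Mf : ∀ y, M (false, y) = (if ((true, y) : Bool × Λ) ∈ Dt ∨ COND y then (true, M' y) else (false, y)) := by
    intro y; simp [M]
  -- useful consequences of the closure hypotheses
  -- (i) T_y ∈ D ⟹ β_u ∈ D for u ⊆ y ; in particular (true,y) ∈ Db
  have T_beta : ∀ y u, ((true, y) : Bool × Λ) ∈ Dt → S'.sub u y → ((true, u) : Bool × Λ) ∈ Db := by
    intro y u hy h; exact hcross _ _ ((hblt_tt u y).mpr h) hy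
  -- (ii) T_y ∈ D ⟹ (true,u) ∈ Fs for u ⊆ y (L ⊆ F*)
  have T_Fs : ∀ y u, ((true, y) : Bool × Λ) ∈ Dt → S'.sub u y → ((true, u) : Bool × Λ) ∈ Fs := by
    intro y u hy h; exact hL _ _ hy ((hblt_tt u y).mpr h)
  -- (iii) τ_y ∈ D ⟹ B_y ∈ Db and ∈ Fs
  have tau_B : ∀ y, ((false, y) : Bool × Λ) ∈ Dt → ((false, y) : Bool × Λ) ∈ Db := by
    intro y hy; exact hcross _ _ ((hblt_f y (false, y)).mpr (hrefl y)) hy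
  have tau_Fs : ∀ y, ((false, y) : Bool × Λ) ∈ Dt → ((false, y) : Bool × Λ) ∈ Fs := by
    intro y hy; exact hL _ _ hy ((hblt_f y (false, y)).mpr (hrefl y))
  -- (iv) T_y ∈ Dt ⟹ B_y ∈ Fs ⊆ Db  (B_y < T_y)
  have T_BFs : ∀ y, ((true, y) : Bool × Λ) ∈ Dt → ((false, y) : Bool × Λ) ∈ Fs := by
    intro y hy; exact hL _ _ hy ((hblt_f y (true, y)).mpr (hrefl y))
  -- when a B-source or β-source at label y is routed through M', the label y is an inner source and lies in the inner interior
  have innerA : ∀ y, (((true, y) : Bool × Λ) ∈ Dt ∨ COND y) → ((false, y) : Bool × Λ) ∉ Dt →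
      (y ∈ Ub ∧ y ∉ Ut ∧ (∀ u', S'.sub u' y → u' ∈ Fsb)) := by
    intro y h hnot
    rcases h with h | h
    · refine ⟨(mUb y).mpr (T_beta y y h (hrefl y)), fun hh => hnot ((mUt y).mp hh), ?_⟩
      intro u' hu'; exact (mFsb u').mpr (T_Fs y u' h hu')
    · refine ⟨(mUb y).mpr h.1, fun hh => hnot ((mUt y).mp hh), ?_⟩
      intro u' hu'; exact (mFsb u').mpr (h.2.2.2.1 u' hu')
  refine ⟨M, ?_, ?_, ?_, ?_⟩
  -- (1) M maps sources into S along EDGEs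
  · rintro ⟨c, x⟩ hDbx hDtx
    cases c
    · -- B-source (false, x)
      rw [Mf]
      by_cases h : ((true, x) : Bool × Λ) ∈ Dt ∨ COND x
      · rw [if_pos h]
        obtain ⟨hA1, hA2, hA3⟩ := innerA x h hDtx
        obtain ⟨m1, m2, m3⟩ := hM1 x hA1 hA2
        obtain ⟨q1, q2⟩ := hM4 x hA1 hA2 hA3
        refine ⟨(mUb _).mp m1, ?_, ?_⟩
        · rw [hΦ_t]; exact fun hh => m2 ((mUt _).mpr hh)
        · rw [hΦ_t, hblt_f]; exact q1
      · rw [if_neg h]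
        refine ⟨hDbx, ?_, ?_⟩
        · rw [hΦ_f]; exact fun hh => h (Or.inl hh)
        · rw [hΦ_f, hblt_f]; exact hrefl x
    · -- β-source (true, x)
      rw [Mt]
      by_cases h : ((false, x) : Bool × Λ) ∈ Dt ∨ COND x
      · rw [if_pos h]
        refine ⟨?_, ?_, ?_⟩
        · rcases h with h | h
          · exact tau_B x h
          · exact hFsDb h.2.2.2.2
        · rw [hΦ_f]; exact hDtx
        · rw [hΦ_f, hblt_tt]; exact hrefl x
      · rw [if_neg h]
        have hA1 : x ∈ Ub := (mUb x).mpr hDbx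
        have hA2 : x ∉ Ut := fun hh => h (Or.inl ((mUt x).mp hh))
        obtain ⟨m1, m2, m3⟩ := hM1 x hA1 hA2
        refine ⟨(mUb _).mp m1, ?_, ?_⟩
        · rw [hΦ_t]; exact fun hh => m2 ((mUt _).mpr hh)
        · rw [hΦ_t, hblt_tf]; exact m3
  -- (2) injectivity on sources
  · rintro ⟨c, x⟩ ⟨c', x'⟩ hDbx hDtx hDbx' hDtx' heq
    cases c <;> cases c'
    · -- both B
      rw [Mf, Mf] at heq
      by_cases h : ((true, x) : Bool × Λ) ∈ Dt ∨ COND x <;> by_cases h' : ((true, x') : Bool × Λ) ∈ Dt ∨ COND x'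
      · rw [if_pos h, if_pos h'] at heq
        obtain ⟨hA1, hA2, -⟩ := innerA x h hDtx
        obtain ⟨hA1', hA2', -⟩ := innerA x' h' hDtx'
        have := hM2 x x' hA1 hA2 hA1' hA2' (by simpa using heq)
        rw [this]
      · rw [if_pos h, if_neg h'] at heq; simp at heq
      · rw [if_neg h, if_pos h'] at heq; simp at heq
      · rw [if_neg h, if_neg h'] at heq; simpa using heq
    · -- B vs β
      rw [Mf, Mt] at heq
      by_cases h : ((true, x) : Bool × Λ) ∈ Dt ∨ COND x <;> by_cases h' : ((false, x') : Bool × Λ) ∈ Dt ∨ COND x'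
      · rw [if_pos h, if_pos h'] at heq; simp at heq
      · rw [if_pos h, if_neg h'] at heq
        -- (true, M' x) = (true, M' x') with x inner-interior routed and x' β non-COND: M' injective gives x = x', then contradiction on types
        simp only [Prod.mk.injEq, true_and] at heq
        obtain ⟨hA1, hA2, -⟩ := innerA x h hDtx
        have hA1' : x' ∈ Ub := (mUb x').mpr hDbx'
        have hA2' : x' ∉ Ut := fun hh => h' (Or.inl ((mUt x').mp hh))
        have hxx := hM2 x x' hA1 hA2 hA1' hA2' heq
        subst hxx
        -- now x = x': h says T_x ∈ Dt or COND x; but (true,x) ∈ Db \ Dt (β-source) so T_x ∉ Dt; hence COND x, contradicting h'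
        exfalso
        rcases h with h | h
        · exact hDtx' h
        · exact h' (Or.inr h)
      · rw [if_neg h, if_pos h'] at heq
        simp only [Prod.mk.injEq] at heq
        obtain ⟨-, hxx⟩ := heq
        subst hxx
        exfalso
        rcases h' with h' | h'
        · exact hDtx h'
        · exact h (Or.inr h')
      · rw [if_neg h, if_neg h'] at heq; simp at heq
    · -- β vs B
      rw [Mt, Mf] at heq
      by_cases h : ((false, x) : Bool × Λ) ∈ Dt ∨ COND x <;> by_cases h' : ((true, x') : Bool × Λ) ∈ Dt ∨ COND x'
      · rw [if_pos h, if_pos h'] at heq; simp at heq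
      · rw [if_pos h, if_neg h'] at heq
        simp only [Prod.mk.injEq] at heq
        obtain ⟨-, hxx⟩ := heq
        subst hxx
        exfalso
        rcases h with h | h
        · exact hDtx' h
        · exact h' (Or.inr h)
      · rw [if_neg h, if_pos h'] at heq
        simp only [Prod.mk.injEq, true_and] at heq
        have hA1 : x ∈ Ub := (mUb x).mpr hDbx
        have hA2 : x ∉ Ut := fun hh => h (Or.inl ((mUt x).mp hh))
        obtain ⟨hA1', hA2', -⟩ := innerA x' h' hDtx'
        have hxx := hM2 x x' hA1 hA2 hA1' hA2' heq
        subst hxx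
        exfalso
        rcases h' with h' | h'
        · exact hDtx h'
        · exact h (Or.inr h')
      · rw [if_neg h, if_neg h'] at heq; simp at heq
    · -- both β
      rw [Mt, Mt] at heq
      by_cases h : ((false, x) : Bool × Λ) ∈ Dt ∨ COND x <;> by_cases h' : ((false, x') : Bool × Λ) ∈ Dt ∨ COND x'
      · rw [if_pos h, if_pos h'] at heq; simpa using heq
      · rw [if_pos h, if_neg h'] at heq; simp at heq
      · rw [if_neg h, if_pos h'] at heq; simp at heq
      · rw [if_neg h, if_neg h'] at heq
        simp only [Prod.mk.injEq, true_and] at heq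
        have hA1 : x ∈ Ub := (mUb x).mpr hDbx
        have hA2 : x ∉ Ut := fun hh => h (Or.inl ((mUt x).mp hh))
        have hA1' : x' ∈ Ub := (mUb x').mpr hDbx'
        have hA2' : x' ∉ Ut := fun hh => h' (Or.inl ((mUt x').mp hh))
        rw [hM2 x x' hA1 hA2 hA1' hA2' heq]
  -- (3) surjectivity onto S
  · rintro ⟨c, s⟩ hDbs hΦs
    cases c
    · -- target (false, s) = B_s with Φ = (true, s) = T_s ∉ Dt
      rw [hΦ_f] at hΦs
      by_cases hc : ((false, s) : Bool × Λ) ∈ Dt ∨ COND s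
      · -- served by the β-source (true, s)  ((s4) or (s3)-COND)
        refine ⟨(true, s), ?_, hΦs, ?_⟩
        · rcases hc with hc | hc
          · exact hcross _ _ ((hblt_tf s s).mpr (hbrefl s)) hc
          · exact hc.1
        · rw [Mt, if_pos hc]
      · -- served by the B-source (false, s) itself ((s1)-else)
        have hns : ((false, s) : Bool × Λ) ∉ Dt := fun hh => hc (Or.inl hh)
        have hnc : ¬ (((true, s) : Bool × Λ) ∈ Dt ∨ COND s) := by
          rintro (hh | hh)
          · exact hΦs hh
          · exact hc (Or.inr hh)
        refine ⟨(false, s), hDbs, hns, ?_⟩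
        rw [Mf, if_neg hnc]
    · -- target (true, s) = β_s with Φ = (false, Φ' s) ∉ Dt: inner target; inner surjectivity gives an inner source u with M' u = s
      rw [hΦ_t] at hΦs
      have hs1 : s ∈ Ub := (mUb s).mpr hDbs
      have hs2 : S'.Φ s ∉ Ut := fun hh => hΦs ((mUt _).mp hh)
      obtain ⟨u, hu1, hu2, hu3⟩ := hM3 s hs1 hs2
      rw [mUb] at hu1; rw [mUt] at hu2
      by_cases hT : ((true, u) : Bool × Λ) ∈ Dt
      · -- u ∈ Y_t: the B-source (false, u) is routed to β_{M' u}
        refine ⟨(false, u), hFsDb (T_BFs u hT), hu2, ?_⟩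
        rw [Mf, if_pos (Or.inl hT), hu3]
      · by_cases hC : COND u
        · refine ⟨(false, u), hFsDb hC.2.2.2.2, hu2, ?_⟩
          rw [Mf, if_pos (Or.inr hC), hu3]
        · refine ⟨(true, u), hu1, hT, ?_⟩
          rw [Mt, if_neg (fun hh => hh.elim hu2 hC), hu3]
  -- (4) containment and F*-membership on the cube interior
  · rintro ⟨c, x⟩ hDbx hDtx hQ
    cases c
    · -- B-source: interior means all (false, y') with y' ⊆ x in Fs
      rw [Mf]
      by_cases h : ((true, x) : Bool × Λ) ∈ Dt ∨ COND x
      · rw [if_pos h, hΦ_t, hsub_ff]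
        obtain ⟨hA1, hA2, hA3⟩ := innerA x h hDtx
        obtain ⟨q1, q2⟩ := hM4 x hA1 hA2 hA3
        exact ⟨q1, (mFsb _).mp q2⟩
      · rw [if_neg h, hΦ_f, hsub_ft]
        exact ⟨hrefl x, hQ (false, x) ((hsub_ff x x).mpr (hrefl x))⟩
    · -- β-source: interior means all (false,u') and (true,u') for u' ⊆ x in Fs; then COND x holds unless τ_x ∈ Dt
      rw [Mt]
      have hFf : ((false, x) : Bool × Λ) ∈ Fs := hQ (false, x) ((hsub_ft x x).mpr (hrefl x))
      have hFt : ∀ u', S'.sub u' x → ((true, u') : Bool × Λ) ∈ Fs := fun u' hu' => hQ (true, u') ((hsub_tt x u').mpr hu')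
      have h : ((false, x) : Bool × Λ) ∈ Dt ∨ COND x := by
        by_cases hτ : ((false, x) : Bool × Λ) ∈ Dt
        · exact Or.inl hτ
        · exact Or.inr ⟨hDbx, hDtx, hτ, hFt, hFf⟩
      rw [if_pos h, hΦ_f, hsub_tt]
      exact ⟨hrefl x, hFf⟩

end AntitheticLegStr

end Summit.CriticalPhenomena.PercolationContinuityZ3.Theorems
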